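import Summits.ValiantsHypothesis.ValiantsHypothesis.Theorems.BarrierLeverChowBenchmarkPairsKernelPeelRows
import Summits.ValiantsHypothesis.ValiantsHypothesis.Theorems.BarrierLeverPartitionMinorsMooreBenchStage

/-!
# Route BarrierLever — item 22038 `ChowBenchmarkPairs`, line `moore-peel`: the KERNEL-WEIGHTED hierarchical
# Moore peel, II — STAGE REDUCTION I (substitution `Y_n ↦ X`, scaling of the attached rows, reduction against
# the fixed rows)

Helper file (`--supports stmt-ValiantsHypothesis-22038`; cell valiant-natproofs, rung V4, 𝒟-side benchmark of
record, line `moore_peel`, card v12 (E)(ii); seat val-np-p4 gen 26).  Closes NO item.  One auxiliary definition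
(`kreducedRow κ r i n Y`, the reduced rows at stage `(i, n+1)`), the weighted verbatim analogue of `reducedRow` of
`…PartitionMinorsMooreBenchStage` (planner p1 g18's memo `HOME/p1/g18/MEMO-g18.md` §2.3 in linear-independence
form), for an arbitrary weight sequence `κ : ℕ → ℕ` (file `…KernelPeelRows`).

* `kreducedRow_of_mem`, `kreducedRow_alpha`, `kreducedRow_beta` — closed forms of the three kinds of reduced rows.
* **`linearIndependent_krow_of_reduced`** — over any commutative ring `R`: if the reduced rows are linearly
  independent over `R[X]`, so are the substituted rows `krow κ r Z` for every node table `Z` with `Z n = X`,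
  `Z b = C (Y b)` (`b < n`) (toolkit `…MooreBenchToolkit`: `linearIndependent_of_block` with the diagonal `X^j`,
  `linearIndependent_of_sub_fixed'`).

WHAT THIS IS NOT: no stub of line `moore_peel` is closed; nothing is claimed about the segment-mean benchmark
`stub_segmentMeanValue` (factorial weights, `det G_183 = 0`); nothing on crux stmt-ValiantsHypothesis-14610 or on
`VP` versus `VNP`.
-/

set_option linter.dupNamespace false

namespace Summit.ValiantsHypothesis.ValiantsHypothesis.Theorems.BarrierLever.MoorePeel

open Polynomial Finset
/-! ## 3. Stage reduction I: substitution, scaling and reduction against the fixed rows -/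

/-- **The reduced kernel rows at stage `(i, n+1)`** (after the substitution `Y_n ↦ X`, the scaling of
the attached rows `(T_j, {n})` by `X^j`, and the reduction against the fixed rows): fixed rows are the
constants `C ∘ krow κ r Y x`; `(T_j, {n}) ↦ (col ↦ [c_i ≤ col] · C(G̃^κ[j, col]) · X^col)`;
`(∅, {b, n}) ↦ (col ↦ Σ_{d ⊆ T_col, bin d ≥ i} C(κ|T∖d| · Y_b^{bin(T∖d)} · κ|d|) · X^{bin d})`. -/
noncomputable def kreducedRow {R : Type*} [CommRing R] (κ : ℕ → ℕ) (r i n : ℕ) (Y : ℕ → R) :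
    RowLabel → (Fin r → R[X]) := fun x col =>
  Sum.elim (fun m => C (krow κ r Y (Sum.inl m) col))
    (Sum.elim
      (fun jb : ℕ × ℕ => if jb.2 = n then
          (if (col : ℕ) < windowStart i then 0 else
            C ((kincl κ jb.1 (col : ℕ) : R)) * X ^ (col : ℕ))
        else C (krow κ r Y (Sum.inr (Sum.inl jb)) col))
      (fun bb : ℕ × ℕ => if bb.2 = n then
          ∑ d ∈ (bits (col : ℕ)).powerset.filter (fun d => i ≤ bin d),
            C ((((κ (bits (col : ℕ) \ d).card : ℕ) : R)) * Y bb.1 ^ bin (bits (col : ℕ) \ d) *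
              ((κ d.card : ℕ) : R)) * X ^ bin d
        else C (krow κ r Y (Sum.inr (Sum.inr bb)) col)))
    x

section Reduced

variable {R : Type*} [CommRing R] (κ : ℕ → ℕ) (r i n : ℕ) (Y : ℕ → R)

/-- Reduced fixed rows are constants. -/
theorem kreducedRow_of_mem (x : RowLabel) (hx : x ∈ stageRows i n) :
    kreducedRow κ r i n Y x = fun col => C (krow κ r Y x col) := by
  funext col
  rcases x with m | ⟨j, b⟩ | ⟨b, b'⟩
  · rfl
  · have hb : b ≠ n := ne_of_lt (inr_inl_mem_stageRows.mp hx).2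
    simp [kreducedRow, hb]
  · have hb : b' ≠ n := ne_of_lt (inr_inr_mem_stageRows.mp hx).2
    simp [kreducedRow, hb]

/-- Reduced attached rows of the peeled point. -/
theorem kreducedRow_alpha (j : ℕ) :
    kreducedRow κ r i n Y (Sum.inr (Sum.inl (j, n))) = fun col : Fin r =>
      if (col : ℕ) < windowStart i then 0 else C ((kincl κ j (col : ℕ) : R)) * X ^ (col : ℕ) := by
  funext col
  simp [kreducedRow]

/-- Reduced pair rows through the peeled point. -/
theorem kreducedRow_beta (b : ℕ) :
    kreducedRow κ r i n Y (Sum.inr (Sum.inr (b, n))) = fun col : Fin r =>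
      ∑ d ∈ (bits (col : ℕ)).powerset.filter (fun d => i ≤ bin d),
        C ((((κ (bits (col : ℕ) \ d).card : ℕ) : R)) * Y b ^ bin (bits (col : ℕ) \ d) *
          ((κ d.card : ℕ) : R)) * X ^ bin d := by
  funext col
  simp [kreducedRow]

end Reduced

/-- **STAGE REDUCTION I** (kernel-weighted).  Over any commutative ring `R`: if the reduced rows
`kreducedRow κ r i n Y` at stage `(i, n+1)` are linearly independent over `R[X]`, then so are the
substituted rows `krow κ r Z` for every node table `Z` with `Z n = X` and `Z b = C (Y b)` for `b < n`. -/
theorem linearIndependent_krow_of_reduced {R : Type*} [CommRing R] (κ : ℕ → ℕ) (r i n : ℕ)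
    (Y : ℕ → R) (Z : ℕ → R[X]) (hZn : Z n = X) (hZlt : ∀ b, b < n → Z b = C (Y b))
    (hred : LinearIndependent R[X]
      (fun x : ↥(stageRows i (n + 1)) => kreducedRow κ r i n Y (x : RowLabel))) :
    LinearIndependent R[X] (fun x : ↥(stageRows i (n + 1)) => krow κ r Z (x : RowLabel)) := by
  classical
  -- the three kinds of labels alive at stage `(i, n+1)`
  set ι₁ : Fin i → ↥(stageRows i (n + 1)) := fun j =>
    ⟨Sum.inr (Sum.inl ((j : ℕ), n)), inr_inl_mem_stageRows.mpr ⟨j.2, Nat.lt_succ_self n⟩⟩ with hι₁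
  set ι₂ : Fin n → ↥(stageRows i (n + 1)) := fun b =>
    ⟨Sum.inr (Sum.inr ((b : ℕ), n)), inr_inr_mem_stageRows.mpr ⟨b.2, Nat.lt_succ_self n⟩⟩ with hι₂
  have hι₁inj : Function.Injective ι₁ := by
    intro j j' e
    have := congrArg Subtype.val e
    simp only [hι₁, Sum.inr.injEq, Sum.inl.injEq, Prod.mk.injEq] at this
    exact Fin.ext this.1
  have htri : ∀ x : ↥(stageRows i (n + 1)), (x : RowLabel) ∈ stageRows i n ∨
      (∃ j', x = ι₁ j') ∨ (∃ b : Fin n, x = ι₂ b) := by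
    rintro ⟨x, hx⟩
    rcases x with m | ⟨j, b⟩ | ⟨b, b'⟩
    · exact Or.inl (inl_mem_stageRows.mpr (inl_mem_stageRows.mp hx))
    · obtain ⟨hj, hb⟩ := inr_inl_mem_stageRows.mp hx
      rcases Nat.lt_succ_iff_lt_or_eq.mp hb with hb | rfl
      · exact Or.inl (inr_inl_mem_stageRows.mpr ⟨hj, hb⟩)
      · exact Or.inr (Or.inl ⟨⟨j, hj⟩, rfl⟩)
    · obtain ⟨hbb, hb'⟩ := inr_inr_mem_stageRows.mp hx
      rcases Nat.lt_succ_iff_lt_or_eq.mp hb' with hb' | rfl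
      · exact Or.inl (inr_inr_mem_stageRows.mpr ⟨hbb, hb'⟩)
      · exact Or.inr (Or.inr ⟨⟨b, hbb⟩, rfl⟩)
  have hι₁_not_fixed : ∀ j', ((ι₁ j' : ↥(stageRows i (n + 1))) : RowLabel) ∉ stageRows i n := by
    intro j' hmem
    exact lt_irrefl n (inr_inl_mem_stageRows.mp hmem).2
  have hι₂_not_fixed : ∀ b, ((ι₂ b : ↥(stageRows i (n + 1))) : RowLabel) ∉ stageRows i n := by
    intro b hmem
    exact lt_irrefl n (inr_inr_mem_stageRows.mp hmem).2
  have hι₂val : ∀ b, ((ι₂ b : ↥(stageRows i (n + 1))) : RowLabel) = Sum.inr (Sum.inr ((b : ℕ), n)) :=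
    fun b => rfl
  have hι₂_not_range : ∀ b, ι₂ b ∉ Set.range ι₁ := by
    rintro b ⟨j, e⟩
    have := congrArg Subtype.val e
    simp [hι₁, hι₂] at this
  have hfixed_not_range : ∀ x : ↥(stageRows i (n + 1)), (x : RowLabel) ∈ stageRows i n →
      x ∉ Set.range ι₁ := by
    rintro x hx ⟨j, rfl⟩
    exact hι₁_not_fixed j hx
  -- STEP 1: scale the attached rows of the peeled point by `X^j`
  obtain ⟨V1, hV1⟩ : ∃ V1 : ↥(stageRows i (n + 1)) → Fin (r) →
      R[X], ∀ x, V1 x =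
      (Sum.elim (fun _ => (1 : R[X]))
        (Sum.elim (fun jb : ℕ × ℕ => if jb.2 = n then Polynomial.X ^ jb.1 else 1) (fun _ => 1))
        (x : RowLabel)) • krow κ (r) Z (x : RowLabel) := ⟨_, fun _ => rfl⟩
  have hV1α : ∀ j', V1 (ι₁ j') = (Polynomial.X : R[X]) ^ (j' : ℕ) •
      krow κ (r) Z (Sum.inr (Sum.inl ((j' : ℕ), n))) := by
    intro j'
    rw [hV1]
    simp [hι₁]
  have hV1off : ∀ x, x ∉ Set.range ι₁ → V1 x = krow κ (r) Z (x : RowLabel) := by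
    intro x hx
    rw [hV1]
    rcases htri x with hfx | ⟨j', rfl⟩ | ⟨b, rfl⟩
    · obtain ⟨y, hy⟩ := x
      rcases y with m | ⟨j, b⟩ | ⟨b, b'⟩
      · simp
      · have hb : b ≠ n := ne_of_lt (inr_inl_mem_stageRows.mp hfx).2
        simp [hb]
      · simp
    · exact absurd (Set.mem_range_self j') hx
    · simp [hι₂]
  apply linearIndependent_of_block _ V1 ι₁ hι₁inj
    (Matrix.diagonal fun j : Fin i => (Polynomial.X : R[X]) ^ (j : ℕ))
    (Matrix.diagonal fun j : Fin i => Polynomial.X ^ (i - (j : ℕ))) (Polynomial.X ^ i)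
    (fun x hx => (Polynomial.monic_X_pow i).mul_right_eq_zero_iff.mp hx)
  · rw [Matrix.diagonal_mul_diagonal]
    ext j j'
    simp only [Matrix.diagonal_apply, Matrix.smul_apply, Matrix.one_apply, smul_eq_mul, mul_ite,
      mul_one, mul_zero]
    split_ifs with hjj
    · rw [← pow_add, Nat.sub_add_cancel (le_of_lt j.2)]
    · rfl
  · intro j'
    rw [hV1α]
    have hdiag : ∀ j : Fin i,
        (Matrix.diagonal (fun j : Fin i => (Polynomial.X : R[X]) ^
          (j : ℕ)) j' j) • (fun c => krow κ (r) Z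
            ((ι₁ j : ↥(stageRows i (n + 1))) : RowLabel) c) =
        if j = j' then (Polynomial.X : R[X]) ^ (j' : ℕ) •
          krow κ (r) Z (Sum.inr (Sum.inl ((j' : ℕ), n))) else 0 := by
      intro j
      by_cases hj : j = j'
      · subst hj
        rw [Matrix.diagonal_apply_eq, if_pos rfl]
      · rw [Matrix.diagonal_apply_ne _ (Ne.symm hj), zero_smul, if_neg hj]
    rw [Finset.sum_congr rfl (fun j _ => hdiag j), Finset.sum_ite_eq' Finset.univ j',
      if_pos (Finset.mem_univ _)]
  · exact hV1off
  -- STEP 2: subtract the fixed rows (monomial rows `e_m`, attached rows `(T_j', {b})`)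
  set F : Finset ↥(stageRows i (n + 1)) :=
    Finset.univ.filter fun x => (x : RowLabel) ∈ stageRows i n with hF
  have hmemF : ∀ x : ↥(stageRows i (n + 1)), x ∈ F ↔ (x : RowLabel) ∈ stageRows i n := fun x => by
    simp [hF]
  set eL : Fin (windowStart i) ⊕ (Fin i × Fin n) → ↥(stageRows i (n + 1)) := fun l =>
    Sum.elim (fun m : Fin (windowStart i) =>
        (⟨Sum.inl (m : ℕ), inl_mem_stageRows.mpr m.2⟩ : ↥(stageRows i (n + 1))))
      (fun jb : Fin i × Fin n => (⟨Sum.inr (Sum.inl ((jb.1 : ℕ), (jb.2 : ℕ))),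
        inr_inl_mem_stageRows.mpr ⟨jb.1.2, Nat.lt_succ_of_lt jb.2.2⟩⟩ : ↥(stageRows i (n + 1))))
      l with heL
  have heF : ∀ l, eL l ∈ F := by
    intro l
    rw [hmemF]
    rcases l with m | ⟨j, b⟩
    · simp only [heL, Sum.elim_inl]
      exact inl_mem_stageRows.mpr m.2
    · simp only [heL, Sum.elim_inr]
      exact inr_inl_mem_stageRows.mpr ⟨j.2, b.2⟩
  obtain ⟨π, hπ⟩ : ∃ π : ↥(stageRows i (n + 1)) → Fin (windowStart i) ⊕ (Fin i × Fin n) →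
      R[X], ∀ x l, π x l =
      Sum.elim (fun _ => (0 : R[X]))
        (Sum.elim
          (fun jb : ℕ × ℕ => if jb.2 = n then
            Sum.elim (fun m : Fin (windowStart i) =>
              Polynomial.C ((kincl κ jb.1 (m : ℕ) : R)) *
                Polynomial.X ^ (m : ℕ))
              (fun _ => 0) l else 0)
          (fun bb : ℕ × ℕ => if bb.2 = n then
            Sum.elim (fun _ => (0 : R[X]))
              (fun jb' : Fin i × Fin n => if (jb'.2 : ℕ) = bb.1 then
                Polynomial.C (((κ (bits (jb'.1 : ℕ)).card : ℕ) : R)) *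
                  Polynomial.X ^ (jb'.1 : ℕ) else 0) l else 0))
        (x : RowLabel) := ⟨_, fun _ _ => rfl⟩
  obtain ⟨V2, hV2⟩ : ∃ V2 : ↥(stageRows i (n + 1)) → Fin (r) →
      R[X],
      ∀ x, V2 x = if x ∈ F then V1 x else V1 x - ∑ l, π x l • V1 (eL l) := ⟨_, fun _ => rfl⟩
  apply linearIndependent_of_sub_fixed' V1 F eL heF π
  rw [show (fun k => if k ∈ F then V1 k else V1 k - ∑ l, π k l • V1 (eL l)) = V2 from
    (funext hV2).symm]
  -- closed forms of the reduced rows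
  have hV2fixed : ∀ x : ↥(stageRows i (n + 1)), (x : RowLabel) ∈ stageRows i n →
      V2 x = fun col => Polynomial.C (krow κ (r) (Y) (x : RowLabel) col) := by
    intro x hx
    rw [hV2, if_pos ((hmemF x).mpr hx), hV1off x (hfixed_not_range x hx)]
    funext col
    exact krow_eq_C_of_mem_stageRows κ _ (Y) Z i n hZlt x hx col
  have hV2α : ∀ j' : Fin i, V2 (ι₁ j') = fun col : Fin (r) =>
      if (col : ℕ) < windowStart i then 0 else
        Polynomial.C ((kincl κ (j' : ℕ) (col : ℕ) : R)) *
          Polynomial.X ^ (col : ℕ) := by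
    intro j'
    rw [hV2, if_neg (fun hm => hι₁_not_fixed j' ((hmemF _).mp hm)), hV1α]
    funext col
    rw [← krow_single_sub_fixed κ (r) Z n hZn i (j' : ℕ) col]
    simp only [Pi.sub_apply, Pi.smul_apply, Finset.sum_apply, smul_eq_mul]
    congr 1
    rw [Fintype.sum_sum_type]
    have h2 : ∑ jb : Fin i × Fin n, π (ι₁ j') (Sum.inr jb) * V1 (eL (Sum.inr jb)) col = 0 :=
      Finset.sum_eq_zero fun jb _ => by rw [hπ]; simp [hι₁]
    rw [h2, add_zero, ← Fin.sum_univ_eq_sum_range (fun m =>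
      (Polynomial.C ((kincl κ (j' : ℕ) m : R)) * Polynomial.X ^ m) *
        (if (col : ℕ) = m then (1 : R[X]) else 0)) (windowStart i)]
    refine Finset.sum_congr rfl fun m _ => ?_
    have hmrange : eL (Sum.inl m) ∉ Set.range ι₁ := by
      rintro ⟨j, e⟩
      have := congrArg Subtype.val e
      simp [hι₁, heL] at this
    rw [hπ, hV1off _ hmrange]
    simp [hι₁, heL, krow]
  have hV2β : ∀ b : Fin n, V2 (ι₂ b) = fun col : Fin (r) =>
      ∑ d ∈ (bits (col : ℕ)).powerset.filter (fun d => i ≤ bin d),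
        Polynomial.C ((((κ (bits (col : ℕ) \ d).card : ℕ) : R)) *
          Y (b : ℕ) ^ bin (bits (col : ℕ) \ d) * ((κ d.card : ℕ) : R)) *
          Polynomial.X ^ bin d := by
    intro b
    rw [hV2, if_neg (fun hm => hι₂_not_fixed b ((hmemF _).mp hm)), hV1off _ (hι₂_not_range b)]
    funext col
    rw [← krow_pair_sub_fixed κ (r) (Y) Z n (b : ℕ) i hZn
      (hZlt b b.2) col]
    simp only [hι₂val, Pi.sub_apply, Pi.smul_apply, Finset.sum_apply, smul_eq_mul]
    congr 1
    rw [Fintype.sum_sum_type]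
    have h1 : ∑ m : Fin (windowStart i), π (ι₂ b) (Sum.inl m) * V1 (eL (Sum.inl m)) col = 0 :=
      Finset.sum_eq_zero fun m _ => by rw [hπ]; simp [hι₂]
    rw [h1, zero_add, Fintype.sum_prod_type]
    rw [← Fin.sum_univ_eq_sum_range (fun j' =>
      (Polynomial.C (((κ (bits j').card : ℕ) : R)) * Polynomial.X ^ j') *
        Polynomial.C (krow κ (r) (Y) (Sum.inr (Sum.inl (j', (b : ℕ)))) col)) i]
    refine Finset.sum_congr rfl fun j' _ => ?_
    have hval : ∀ b' : Fin n, π (ι₂ b) (Sum.inr (j', b')) * V1 (eL (Sum.inr (j', b'))) col =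
        if b' = b then (Polynomial.C (((κ (bits (j' : ℕ)).card : ℕ) : R)) *
          Polynomial.X ^ (j' : ℕ)) * Polynomial.C (krow κ (r) (Y)
            (Sum.inr (Sum.inl ((j' : ℕ), (b : ℕ)))) col) else 0 := by
      intro b'
      have hmrange : eL (Sum.inr (j', b')) ∉ Set.range ι₁ := by
        rintro ⟨j, e⟩
        have := congrArg Subtype.val e
        simp only [hι₁, heL, Sum.elim_inr, Sum.inr.injEq, Sum.inl.injEq,
          Prod.mk.injEq] at this
        exact absurd this.2 (ne_of_gt b'.2)
      rw [hπ, hV1off _ hmrange]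
      simp only [hι₂, heL, Sum.elim_inr]
      by_cases hb' : b' = b
      · subst hb'
        rw [krow_eq_C_of_mem_stageRows κ _ (Y) Z i n hZlt _
          (inr_inl_mem_stageRows.mpr ⟨j'.2, b'.2⟩) col]
        simp
      · simp [hb', Fin.val_inj]
    simp_rw [hval]
    rw [Finset.sum_ite_eq' Finset.univ b, if_pos (Finset.mem_univ _)]
  -- the reduced family is `kreducedRow`
  have hV2eq : V2 = fun x : ↥(stageRows i (n + 1)) => kreducedRow κ r i n Y (x : RowLabel) := by
    funext x
    rcases htri x with hx | ⟨j', rfl⟩ | ⟨b, rfl⟩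
    · rw [hV2fixed x hx, kreducedRow_of_mem κ r i n Y _ hx]
    · rw [hV2α, kreducedRow_alpha]
    · rw [hV2β, hι₂val, kreducedRow_beta]
  rw [hV2eq]
  exact hred

end Summit.ValiantsHypothesis.ValiantsHypothesis.Theorems.BarrierLever.MoorePeel
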